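/-
Copyright: lit-balaban Phase-2 proof seat p27 (gen 35).  Statement-level skeleton of a published paper; no proof claims beyond what the
kernel checks below.
-/
import Literature.MathematicalPhysics.QuantumFieldTheory.BalabanImbrieJaffe1984to88.BIJ88NeumannPropagatorSmallFieldCubeDeriv
import Literature.MathematicalPhysics.QuantumFieldTheory.BalabanImbrieJaffe1984to88.BIJ85ScalarPropagatorSupDecayHolder

/-!
# [BalabanImbrieJaffe1988] p. 263 / [BalabanImbrieJaffe1985] §7.3 p. 326 / [6] (1.9) p. 573 — **THE HÖLDER MEMBER OF [6] (1.9) FOR THE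
# COVARIANT DERIVATIVE OF THE CUBE NEUMANN PROPAGATORS `G_k(□,u)` AT SMALL NON-FLAT FIELDS, `k`-UNIFORM, OPERATOR (`‖f‖_∞`) FORM —
# the local two-bond interior estimate at an axis-parallel DEEP pair, in the axis-rooted gauge** (file 2 of the TAKING; file 3
# `BIJ88NeumannPropagatorSmallFieldCubeHolderDecay` = the gauge-invariant restatement, all deep pairs, the (7.3.1)-type forms)

T. Bałaban, J. Imbrie, A. Jaffe, *Effective action and cluster properties of the abelian Higgs model*, Commun. Math. Phys. **114** (1988)
257–315 [BalabanImbrieJaffe1988], p. 263 [PDF 7]: *"Bounds analogous to (2.30), (2.31) hold for covariant derivatives and Hölder derivatives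
of G_{k,loc}(u) of order less than two."*; [I] = T. Bałaban, J. Imbrie, A. Jaffe, *Renormalization of the Higgs model: minimizers, propagators
and the stability of mean field theory*, Commun. Math. Phys. **97** (1985) 299–329 [BalabanImbrieJaffe1985], §7.3 p. 326 [PDF 28]: *"The
propagators arising from Δ_k(u_k), under the restriction (7.3.1) on the gauge field, also satisfy the regularity and decay estimates of
[7]"*; [6] = [7] of [I] = T. Bałaban, *Regularity and decay of lattice Green's functions*, Commun. Math. Phys. **89** (1983) 571–597
[Balaban1983RegularityDecay], Theorem p. 573, (1.9): *"for α < 1 there exist positive constants δ₀, c₀, R₀ independent of A, k, Ω and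
depending on d, M only, c₀ on α also, such that … 1/|x − x′|^α |U(A(Γ_{x,x′}))(D^η_{A,μ}G_k(Ω,A)f)(x′) − (D^η_{A,μ}G_k(Ω,A)f)(x)| ≦
c₀exp(−δ₀dist({x,x′}, supp f))‖f‖_∞ (1.9) for x, x′ ∈ Ω, and satisfying the condition dist({x,x′},Ω^c) ≧ R₀"*.

statement-level skeleton of published theorems with citation tags; proofs where landed; nothing here is a claim about the Yang–Mills mass gap

PDFs held: `paper:balaban1988-cmp114-bij-abelian-higgs-effective-action` (p. 263 [PDF 7]); `paper:balaban1985-cmp97-bij-higgs-minimizers`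
(p. 326 [PDF 28], text layer re-read 2026-08-23); `paper:balaban1983-cmp89-regularity-decay` (p. 573 [PDF 3]).

CITATION HEADER (lean-in-tree rule).  Part of the lit-balaban TYPED SKELETON (HOME `run/shared/lean/pub/lit-balaban/`), PHASE-2 proof seat
p27 gen 35 (unit `lit-balaban-p27-g35`; TAKING line HOME/STATUS.md 2026-08-23T03:09:50Z, amended 03:19:23Z; free-target protocol G.5-34(d);
no objection from p30 (engine owner, torus lane) / p34 (cube derivative member) / r18 / r15 in the window; item (1) of the TAKING yielded to
p34 gen 17).  WHAT THIS FILE IS: the CUBE twin of p30 gen 26's torus leg estimate `BIJ85ScalarPropagatorSupDecayHolder.holder19_leg_gauged`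
(p349509): p30's LOCAL two-bond interior estimate `local_holder_bound` (stated for the torus operator `N_T(u)` with an arbitrary source `f′`,
used only on a ball) TRANSPLANTED to p31's cube propagator of record `G_k(□,u) = gBox (α_kL^{kd}) ε⁻¹ u k □`, `□ = cubeT hPd (L^k) c (L^k·M)`
([BalabanImbrieJaffe1988] (2.27)/(5.6.10) with `Ω = □`), at axis-parallel pairs DEEP inside `□`.  Rows served on ACCEPT (cells only, no head
change): **C2.Claim@263** (owner r18: the order-`1+α` Hölder half of the p. 263 sentence for the cubes `□_α` at non-flat small `u` — the
analytic core; the gauge-invariant all-pairs statement is file 3), **C1.Eq7.3.1-7.3.2** (owner r15: located member — with p27 gen 34's value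
member p347259 and p34 gen 17's covariant-derivative member p349321 this completes the cube list value / `D_u` / Hölder of the p. 326
sentence at small non-flat fields, the torus list being p341384 / p345594 / p349509–p350355).  USED BY NAME, never restated: p30's
`local_holder_bound`, `div_rpow_mul_eq`, `rpow_neg_le_of_le_mul`, `rpow_le_mul_rpow` (`BIJ85ScalarPropagatorSupDecayHolder`), `flat_kernel_holder`
(`BIJ85FlatPropagatorKernelHolder`), `centredGaugeDir` / `dist1_centredGaugeDir_le(_min)` (`BIJ85BiCentredAxialGauge`), `norm_covDiff_gaugeAct`
/ `two_mul_pow_le_sitesPerDir` / `gamma_nsq_le_one` (`BIJ85ScalarPropagatorSupDecayDeriv`), `supDist_shift_le_succ` / `supDist_unshift_le_succ`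
(`BIJ85TorusTentCutoff`); p34's `decay110_smallField_cube_deriv`, `nOp_univ_mulVec_apply_eq_of_interior`, `nOp_gaugeAct_mulVec_apply`
(`BIJ88NeumannPropagatorSmallFieldCubeDeriv`); p27 gen 34's `decay110_smallField_cube` (`BIJ88NeumannPropagatorSmallFieldSupDecay`); p31's
`nOp` / `gBox` / `cubeT` / `isBlockUnion_cubeT`.

THE MATHEMATICS (ours — DIVERGENCE OF METHOD from the printed route, disclosed as in p27's/p30's/p34's files: the print defers to an extension
of [7]'s random-walk expansion; here p30's perturbative interior Hölder estimate, transplanted from the torus to the cube exactly as p34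
transplanted the gradient estimate).  Fix `φ = G_k(□,u)f`, an axis-parallel pair `x₁ = x₀ + ρe_i` (`1 ≤ ρ`, `64ρ ≤ L^k`), the radius
`r = ⌊L^k/8⌋` and p30's axis-rooted tree gauge `h = centredGaugeDir u x₀ (2r) i` of the `2r`-ball around `x₀` (all bonds based on the axis
segment through `x₀` are trivial for `u′ = u^h`, so the (1.9) transport along the axis is `1` and the covariant derivatives at the two bonds
`⟨x₀, x₀+e_μ⟩`, `⟨x₁, x₁+e_μ⟩` are plain differences of `ψ = hφ`).  THE CUBE EQUATION READ BY THE TORUS OPERATOR (p34 §1–§2): the torus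
source `f′ := N_T(u′)ψ` agrees with `hf` at every site of `□` all of whose bonds lie in `□` (`(N_T(u′)ψ)(z) = (N_□(u′)ψ)(z) = h(z)f(z)`), in
particular on the whole `2r`-ball when `x₀` is `2L^k`-deep (`dist_∞(x₀, T∖□) ≥ 2L^k ≥ 2r + 2`).  So p30's `local_holder_bound` — which takes the
torus equation `N_T(u′)ψ = f′` globally but reads `f′` only on the `2r`-ball — applies VERBATIM with: `F_loc` = the bound of `f` on the ball;
`S` = p27's cube VALUE bound `c_v(L^kε)²e^{−t dist/L^k}F` (no depth needed — an operator bound at every site); `M_loc` = p34's cube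
COVARIANT-DERIVATIVE bound `c_d·ε(L^kε)e^{−t dist/L^k}F` at the bonds of the `2r`-ball, all of which are `L^k`-deep (`2L^k − 2r ≥ L^k`); the
gauge weight `γ·min(|z−x₀|, |z−x₁|)` with `γ = dθ` from p30's `dist1_centredGaugeDir_le_min` (plaquettes within `θ`, `(d)θL^{2k} ≤ 1`,
`d = P.d − 1`); the Hölder envelopes of the flat torus difference kernel `ΔK = K_{b₁} − K_{b₀}` from p30's `flat_kernel_holder`
(`A = C_Hε²ρ^α`).  The five terms of `local_holder_bound` are then `≲ ρ^αL^{k(1−α)}ε²e^{−tD/L^k}F` exactly as in p30's §4 — the arithmetic is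
p30's, line by line.

WHAT IS PROVED (theorems only; 0 `sorry`; standard axioms; no definition, no `Prop`-valued fact).
* §1 **`source_eq_on_ball`** — for a block union `Ω`, a gauge transformation `h`, `ψ = h·G_k(Ω,u)f` and a site `z` with `z, z ± e_ν ∈ Ω`:
  `(N_T(u^h)ψ)(z) = h(z)f(z)` (p34's two lemmas composed); **`deep_of_ball`** — if `dist_∞(x₀, T∖□) ≥ 2L^k` and `8r ≤ L^k` then every `w` with
  `|x₀ − w|_∞ ≤ 2r + 1` lies in `□` and every `z` with `|x₀ − z|_∞ ≤ 2r` is `L^k`-deep.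
* §2 **`holder19_cube_leg_gauged`** — for `1 ≤ d`, `d + 1 ≤ 3`, `L` odd `> 1`, `a > 0`, `0 ≤ α < 1` THERE EXIST `t₀, c₀ > 0` (from `(d, L, a, α)`;
  `t₀` from `(d, L, a)` only) such that for every `P` with `P.d = d+1`, `P.L = L`, every `1 ≤ k ≤ K`, every fitting no-wrap cube
  `□ = cubeT hPd (L^k) c (L^k·M)` (`M_i ≥ 1`, `c_iL^k + L^kM_i ≤ |T|`, `L^kM_i < |T|`), every `U(1)` field `u` with `‖u(∂p) − 1‖ ≤ θ` for all
  plaquettes, `2(d+1)³(L^{2k}θ)² ≤ 1`, p34's/p27's bondwise `(T, δ)` on `□` (`T` on the intra-block bonds of `□*`, `δ` on the composite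
  transports over `□`, `2(L^k−1)L^k(d+1)T² + 2δ² ≤ 1/2`), every axis-parallel pair `x₀, x₁` (`x₁,ν = x₀,ν` for `ν ≠ i`) with
  `1 ≤ |x₀−x₁|_∞`, `64|x₀−x₁|_∞ ≤ L^k` and `dist_∞(x₀, T∖□) ≥ 2L^k`, every direction `μ` and every `f` with `|f| ≤ F` vanishing at sup-distance
  `< D` from `x₀`: (a) every bond based on the axis segment `{z : z_ν = x₀,ν (ν ≠ i), |z−x₀|_∞ ≤ |x₀−x₁|_∞}` is trivial for `u^h`,
  `h = centredGaugeDir u x₀ (2⌊L^k/8⌋) i`; (b) for `ψ = h·G_k(□,u)f`: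
  `‖(ψ(x₁+e_μ) − ψ(x₁)) − (ψ(x₀+e_μ) − ψ(x₀))‖ ≤ c₀(|x₀−x₁|_∞/L^k)^α(L^kε)·ε·e^{−t₀D/L^k}F`.

HONEST SCOPE.  (i) This file is the LEG ESTIMATE in a chosen gauge at an axis-parallel pair; the gauge-invariant form with the explicit axis
transport, general pairs (staircase of `d+1` legs), far pairs and the `(L^kε)`-normalised (1.9) shape are file 3.  (ii) DEEP PAIRS ONLY:
`dist_∞(x₀, T∖□) ≥ 2L^k` — two units of the `L^{−k}`-lattice, i.e. [6]'s restriction *"dist({x,x′},Ω^c) ≥ R₀"* with `R₀ = 2` blocks; [6]'s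
REMARK that rectangular parallelepipeds need no restriction is NOT reproduced (the Neumann boundary layer would need the reflected kernels of
[6] (2.42); not done — as in p34's file).  (iii) CUBES ONLY (`L^kM_i < |T|`, `M_i ≥ 1`), as the value and derivative members; a general block
union is not treated.  (iv) `P.d = d + 1 ∈ {2, 3}` (p27's tilted row needs `≤ 3`, p30's flat envelopes need `≥ 2`), `L` odd `> 1`,
`1 ≤ k ≤ K`.  (v) Hypotheses = the UNION of p34's §4 hypotheses (bondwise `(T, δ)` feeding p27's value member, plaquette `θ` feeding the axial
gauges and p34's derivative member); the (7.3.1)-type plaquette-only form is file 3 (blockwise centred gauge, p34's v1.2 `smallField_blockGauge`);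
THE PRINTED (7.3.1) constrains the UNIT-lattice plaquettes of `v` (`|v(∂p) − 1| ≦ e_kμ(e_k)`, p. 326), the files' `θ` the FINE plaquettes of
`u` (referee ref-5 D-g64-1) — nothing is asserted about that passage.  (vi) Constants `t₀ = min(t_v, t_d, 1)`, `c₀ = C_LC_H(e + c_de + c_ve³ +
256c_ve³ + 2ac_ve³) + 1` — p30's formula with the cube constants; `set_option maxHeartbeats 800000` on §2 (p30's bookkeeping verbatim).
DIVERGENCE OF METHOD as stated.  Nothing here is summit progress, continuum or Clay.  Unit `lit-balaban-p27`
(literature-prover-lit-balaban-p27-g35-0), HOME `run/shared/lean/pub/lit-balaban/`, 2026-08-23.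
-/

open scoped BigOperators ComplexConjugate
open Finset Matrix

namespace Literature.MathematicalPhysics.QuantumFieldTheory.BalabanImbrieJaffe1984to88.BIJ88NeumannPropagatorSmallFieldCubeHolder

open Literature.MathematicalPhysics.QuantumFieldTheory.Balaban1983to89
open LatticeFieldCalculus (supDist)
open B3TorusRadialSums (cdist cdist_le_supDist supDist_comm supDist_eq_sup_cdist supDist_eq_zero_iff cdist_neg)
open BIJ85Ineq722Torus (supDist_triangle)
open BIJ88Sect3Statements (U1 toC cfg covD starB mem_starB norm_toC toC_one)
open BIJ85BlockAveragesTorus BIJ85BlockAveragesTorusK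
open BIJ88NeumannNoZeroModesTorus (IsBlockUnion)
open BIJ88NeumannPropagator227Torus (nOp gBox)
open BIJ88NeumannPropagatorFlatDecayCube (cubeT isBlockUnion_cubeT)
open BIJ85ScalarPropagatorSupDecayDeriv (norm_covDiff_gaugeAct dist1_plaqHol_le_of_plaqC two_mul_pow_le_sitesPerDir gamma_nsq_le_one)
open BIJ85TorusTentCutoff (supDist_shift_le_succ supDist_unshift_le_succ supDist_shift_le_one')
open BIJ85BiCentredAxialGauge (centredGaugeDir dist1_centredGaugeDir_le dist1_centredGaugeDir_le_min)
open BIJ85ScalarPropagatorSupDecayHolder (local_holder_bound div_rpow_mul_eq rpow_neg_le_of_le_mul rpow_le_mul_rpow)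
open BIJ88NeumannPropagatorSmallFieldSupDecay (decay110_smallField_cube)
open BIJ88NeumannPropagatorSmallFieldCubeDeriv (decay110_smallField_cube_deriv nOp_univ_mulVec_apply_eq_of_interior nOp_gaugeAct_mulVec_apply)

noncomputable section

variable {P : Params}

/-! ## §1 The cube equation read by the torus operator on a deep ball -/

section Source

/-- kernel: **the torus source of the gauge copy of the cube solution is `hf` at every interior site** — for a block union `Ω`, a gauge
transformation `h`, `ψ = h·G_k(Ω,u)f` and `z ∈ Ω` with `z ± e_ν ∈ Ω` for all `ν`: `(N_T(u^h)ψ)(z) = h(z)f(z)` (p34's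
`nOp_univ_mulVec_apply_eq_of_interior` + `nOp_gaugeAct_mulVec_apply`). [cite: BalabanImbrieJaffe1988, (2.27) p.263; BalabanImbrieJaffe1985, (2.7) p.303] -/
theorem source_eq_on_ball {k : ℕ} (hk : 0 + k ≤ P.m + P.K) {a c : ℝ} (hc : c ≠ 0) (ha : 0 < a) (h : GaugeTransf P 0 U1)
    (U : GaugeField P 0 U1) {Ω : Finset (Balaban1983to89.Site P 0)} (hΩ : IsBlockUnion k Ω) (f : Balaban1983to89.Site P 0 → ℂ)
    {z : Balaban1983to89.Site P 0} (hz : z ∈ Ω) (hs : ∀ ν, z.shift ν ∈ Ω) (hu : ∀ ν, z.unshift ν ∈ Ω) :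
    (nOp a c (GaugeField.gaugeAct h U) k univ *ᵥ fun w => toC (h w) * (gBox a c U k Ω *ᵥ f) w) z = toC (h z) * f z := by
  rw [nOp_univ_mulVec_apply_eq_of_interior a c (GaugeField.gaugeAct h U) hΩ _ hz hs hu]
  exact nOp_gaugeAct_mulVec_apply hk hc ha h U hΩ f hz

/-- kernel: **a `2L^k`-deep centre has its `(2r+1)`-ball in the cube and its `2r`-ball `L^k`-deep** (`8r ≤ L^k`): if `2L^k ≤ |x₀ − w|_∞`
for every `w ∉ □` then (a) `|x₀ − w|_∞ ≤ 2r + 1 → w ∈ □`, (b) `|x₀ − z|_∞ ≤ 2r → (w ∉ □ → L^k ≤ |z − w|_∞)`.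
[cite: Balaban1983RegularityDecay, Theorem p.573 «dist({x,x′},Ω^c) ≥ R₀»] -/
theorem deep_of_ball {k r : ℕ} (hr : 8 * r ≤ P.L ^ k) {Q : Finset (Balaban1983to89.Site P 0)} {x₀ : Balaban1983to89.Site P 0}
    (hdeep : ∀ w, w ∉ Q → 2 * P.L ^ k ≤ supDist x₀ w) :
    (∀ w, supDist x₀ w ≤ 2 * r + 1 → w ∈ Q) ∧
      (∀ z, supDist x₀ z ≤ 2 * r → ∀ w, w ∉ Q → P.L ^ k ≤ supDist z w) := by
  have hL : 1 ≤ P.L ^ k := Nat.one_le_pow _ _ P.L_pos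
  refine ⟨fun w hw => ?_, fun z hz w hwQ => ?_⟩
  · by_contra hwQ
    have := hdeep w hwQ
    omega
  · have h1 := hdeep w hwQ
    have h2 := supDist_triangle x₀ z w
    omega

end Source

/-! ## §2 [6] (1.9): the HÖLDER member at an axis-parallel DEEP pair of the cube, in the axis-rooted gauge, `k`-uniform -/

section Leg

variable {d : ℕ}

set_option maxHeartbeats 800000 in
/-- **THE HÖLDER MEMBER OF [6] (1.9) FOR THE COVARIANT DERIVATIVE OF THE CUBE NEUMANN PROPAGATOR `G_k(□,u)` AT SMALL NON-FLAT FIELDS,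
AXIS-PARALLEL DEEP PAIRS, IN THE AXIS-ROOTED GAUGE, `k`-UNIFORM** — for [BalabanImbrieJaffe1988] p. 263 *"Bounds analogous to (2.30), (2.31)
hold for covariant derivatives and Hölder derivatives of G_{k,loc}(u) of order less than two"*, [BalabanImbrieJaffe1985] p. 326 *"The
propagators arising from Δ_k(u_k), under the restriction (7.3.1) on the gauge field, also satisfy the regularity and decay estimates of [7]"* and
[Balaban1983RegularityDecay] (1.9) *"|x−x′|^{−α}|U(A(Γ_{x,x′}))(D^η_{A,μ}G_k(Ω,A)f)(x′) − (D^η_{A,μ}G_k(Ω,A)f)(x)| ≤ c₀e^{−δ₀dist({x,x′},supp f)}‖f‖_∞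
… dist({x,x′},Ω^c) ≥ R₀"*, for p31's CUBE propagator of record `G_k(□,u) = gBox (α_kL^{kd}) ε⁻¹ u k □`, `□ = cubeT hPd (L^k) c (L^k·M)`, under the
union of the hypotheses of p27's cube value member (`decay110_smallField_cube`: bondwise `(T, δ)` on `□`) and of p34's cube derivative member
(`decay110_smallField_cube_deriv`: plaquettes within `θ` of `1`, `2(d+1)³(L^{2k}θ)² ≤ 1`): for `1 ≤ d`, `d + 1 ≤ 3`, `L` odd `> 1`, `a > 0`,
`0 ≤ α < 1` there are `t₀, c₀ > 0` (on `d, L, a, α`) such that for every volume, every `1 ≤ k ≤ K`, every fitting cube, every such field, every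
AXIS-PARALLEL pair `x₀`, `x₁` (`x₁,ν = x₀,ν` for `ν ≠ i`) with `1 ≤ |x₀−x₁|_∞`, `64|x₀−x₁|_∞ ≤ L^k` and `dist_∞(x₀, T∖□) ≥ 2L^k` (here [6]'s `R₀`
= two units of the `L^{−k}`-lattice), every direction `μ` and every `f` with `|f| ≤ F` vanishing at sup-distance `< D` from `x₀`, in p30's tree
gauge `h = centredGaugeDir u x₀ (2⌊L^k/8⌋) i` EVERY bond based on the axis segment is trivial (so the transport `U(Γ_{x₀,x₁})` along the axis is
`1` and the covariant derivatives at the two bonds are plain differences) and, for `ψ = h·G_k(□,u)f`,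
`‖(ψ(x₁+e_μ) − ψ(x₁)) − (ψ(x₀+e_μ) − ψ(x₀))‖ ≤ c₀(|x₀−x₁|_∞/L^k)^α(L^kε)·ε·e^{−t₀D/L^k}F`.  Method: p30's `local_holder_bound` at `r = ⌊L^k/8⌋`
applied to the torus operator `N_T(u^h)` and `ψ`, whose torus source `N_T(u^h)ψ` equals `hf` on the `2r`-ball (§1); `S` from p27's cube
value bound, `M_loc` from p34's cube derivative bound (bonds of the `2r`-ball are `L^k`-deep), the axis-rooted gauge weight `γ = dθ`
(`d = P.d − 1`) and p30's flat Hölder envelopes `A = C_Hε²ρ^α`; p30's arithmetic verbatim.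
[cite: BalabanImbrieJaffe1988, p.263; BalabanImbrieJaffe1985, (7.3.1) p.326; Balaban1983RegularityDecay, (1.9) p.573] -/
theorem holder19_cube_leg_gauged (d L : ℕ) (hd1 : 1 ≤ d) (hd3 : d + 1 ≤ 3) (hL : Odd L ∧ 1 < L) {a : ℝ} (ha : 0 < a) {α : ℝ}
    (hα0 : 0 ≤ α) (hα1 : α < 1) :
    ∃ t₀ c₀ : ℝ, 0 < t₀ ∧ 0 < c₀ ∧ ∀ (P : Params) (hPd : P.d = d + 1), P.L = L →
      ∀ k : ℕ, 1 ≤ k → k ≤ P.K → ∀ (c M : Fin (d + 1) → ℕ), (∀ i, 1 ≤ M i) →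
        (∀ i, c i * P.L ^ k + P.L ^ k * M i ≤ P.sitesPerDir 0) → (∀ i, P.L ^ k * M i < P.sitesPerDir 0) →
        ∀ (U : GaugeField P 0 U1) (θ T δ : ℝ), 0 ≤ θ →
          (∀ p : Balaban1983to89.Plaq P 0, ‖toC (GaugeField.plaqHol U p) - 1‖ ≤ θ) →
          2 * (P.d : ℝ) ^ 3 * (((P.L : ℝ) ^ k) ^ 2 * θ) ^ 2 ≤ 1 →
          (∀ b ∈ starB (cubeT hPd (P.L ^ k) c fun i => P.L ^ k * M i), blkIter k b.src = blkIter k b.tgt → ‖toC (U b) - 1‖ ≤ T) →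
          (∀ y ∈ cubeT hPd (P.L ^ k) c (fun i => P.L ^ k * M i), ‖holCK U k y - 1‖ ≤ δ) →
          2 * (((P.L : ℝ) ^ k - 1) * (P.L : ℝ) ^ k) * P.d * T ^ 2 + 2 * δ ^ 2 ≤ 1 / 2 →
        ∀ (x₀ x₁ : Balaban1983to89.Site P 0) (i μ : Fin P.d), (∀ ν, ν ≠ i → x₁ ν = x₀ ν) →
          1 ≤ supDist x₀ x₁ → 64 * supDist x₀ x₁ ≤ P.L ^ k →
          (∀ w, w ∉ cubeT hPd (P.L ^ k) c (fun i => P.L ^ k * M i) → 2 * P.L ^ k ≤ supDist x₀ w) →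
        ∀ (f : Balaban1983to89.Site P 0 → ℂ) (F D : ℝ),
          (∀ z, ‖f z‖ ≤ F) → (∀ z, f z ≠ 0 → D ≤ (supDist x₀ z : ℝ)) →
          (∀ (z : Balaban1983to89.Site P 0) (μ' : Fin P.d), (∀ ν, ν ≠ i → z ν = x₀ ν) → supDist x₀ z ≤ supDist x₀ x₁ →
              cfg (GaugeField.gaugeAct (centredGaugeDir U x₀ (2 * (P.L ^ k / 8)) i) U) ⟨z, μ'⟩ = 1) ∧
          ‖(toC (centredGaugeDir U x₀ (2 * (P.L ^ k / 8)) i (x₁.shift μ)) *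
                (gBox (B1RG242Torus.α P a k * (P.L : ℝ) ^ (k * P.d)) P.eps⁻¹ U k
                  (cubeT hPd (P.L ^ k) c fun i => P.L ^ k * M i) *ᵥ f) (x₁.shift μ) -
              toC (centredGaugeDir U x₀ (2 * (P.L ^ k / 8)) i x₁) *
                (gBox (B1RG242Torus.α P a k * (P.L : ℝ) ^ (k * P.d)) P.eps⁻¹ U k
                  (cubeT hPd (P.L ^ k) c fun i => P.L ^ k * M i) *ᵥ f) x₁) -
            (toC (centredGaugeDir U x₀ (2 * (P.L ^ k / 8)) i (x₀.shift μ)) *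
                (gBox (B1RG242Torus.α P a k * (P.L : ℝ) ^ (k * P.d)) P.eps⁻¹ U k
                  (cubeT hPd (P.L ^ k) c fun i => P.L ^ k * M i) *ᵥ f) (x₀.shift μ) -
              toC (centredGaugeDir U x₀ (2 * (P.L ^ k / 8)) i x₀) *
                (gBox (B1RG242Torus.α P a k * (P.L : ℝ) ^ (k * P.d)) P.eps⁻¹ U k
                  (cubeT hPd (P.L ^ k) c fun i => P.L ^ k * M i) *ᵥ f) x₀)‖
            ≤ c₀ * ((supDist x₀ x₁ : ℝ) / (P.L : ℝ) ^ k) ^ α * P.spacing k * P.eps * Real.exp (-(t₀ * D / (P.L : ℝ) ^ k)) * F := by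
  classical
  obtain ⟨t₁, c_v, ht₁, hc_v, hval⟩ := decay110_smallField_cube d (L - 1) hd3 (by omega) ha
  obtain ⟨t₂, c_d, ht₂, hc_d, hder⟩ := decay110_smallField_cube_deriv d L hd1 hd3 hL ha
  obtain ⟨C_H, hCH, hhol⟩ := BIJ85FlatPropagatorKernelHolder.flat_kernel_holder (d + 1) L (by omega) hL ha (le_refl (0 : ℝ)) hα0 hα1
  obtain ⟨C_L, hCL, hloc⟩ := local_holder_bound (d + 1) (by omega) hα0 hα1
  -- the rate and the constant
  set t : ℝ := min (min t₁ t₂) 1 with htdef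
  have ht : 0 < t := lt_min (lt_min ht₁ ht₂) one_pos
  have ht1 : t ≤ 1 := min_le_right _ _
  have htt₁ : t ≤ t₁ := (min_le_left _ _).trans (min_le_left _ _)
  have htt₂ : t ≤ t₂ := (min_le_left _ _).trans (min_le_right _ _)
  set e : ℝ := Real.exp 1 with hedef
  have he1 : 1 ≤ e := by rw [hedef]; exact Real.one_le_exp (by norm_num)
  have he0 : 0 < e := Real.exp_pos 1
  set K₁ : ℝ := C_L * C_H * (e + c_d * e + c_v * e ^ 3 + 256 * c_v * e ^ 3 + 2 * a * c_v * e ^ 3) with hK₁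
  refine ⟨t, K₁ + 1, ht, by positivity, ?_⟩
  intro P hPd hPL k hk1 hkK cc M hM hfit hN U θ T δ hθ0 hθ hsmall hInt hTree hsmallT x₀ x₁ i μ hx₁ hρ1 hρ64 hdeep f F D hF hsupp
  have hk : k ≤ P.m + P.K := hkK.trans (Nat.le_add_left _ _)
  have hk0 : 0 + k ≤ P.m + P.K := by omega
  have hPL' : P.L = L - 1 + 1 := by omega
  have hvalP := hval P hPd hPL' k hk1 hk cc M hM hfit hN U T δ hInt hTree hsmallT
  have hderP := hder P hPd hPL k hk1 hkK cc M hM hfit hN U θ T δ hθ0 hθ hsmall hInt hTree hsmallT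
  have hholP := hhol P hPd hPL k hk1 hkK
  set Q : Finset (Balaban1983to89.Site P 0) := cubeT hPd (P.L ^ k) cc fun i => P.L ^ k * M i with hQdef
  -- basic quantities
  have hd1' : 1 ≤ P.d := by omega
  have hLpos : (0 : ℝ) < P.L := P.cast_L_pos
  have hL1 : (1 : ℝ) < P.L := B1RG242Torus.one_lt_cast_L P
  have hε : 0 < P.eps := P.eps_pos
  set n : ℝ := (P.L : ℝ) ^ k with hndef
  have hn : 0 < n := pow_pos hLpos k
  have hnnat : ((P.L ^ k : ℕ) : ℝ) = n := by push_cast; rw [hndef]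
  have hsp : P.spacing k = n * P.eps := rfl
  have hsp0 : 0 < P.spacing k := P.spacing_pos k
  have hα : 0 < B1RG242Torus.α P a k := mul_pos (B1.aSeq_pos ha hL1 hk1) (inv_pos.2 (pow_pos hsp0 2))
  have hαa : B1RG242Torus.α P a k * P.spacing k ^ 2 ≤ a := by
    show B1.aSeq a P.L k * (P.spacing k ^ 2)⁻¹ * P.spacing k ^ 2 ≤ a
    rw [inv_mul_cancel_right₀ (pow_ne_zero 2 hsp0.ne')]
    exact B1.aSeq_le ha hL1 k hk1
  set a' : ℝ := B1RG242Torus.α P a k * (P.L : ℝ) ^ (k * P.d) with ha'def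
  have ha' : 0 < a' := mul_pos hα (pow_pos hLpos _)
  have hc' : P.eps⁻¹ ≠ 0 := inv_ne_zero hε.ne'
  have hF0 : 0 ≤ F := (norm_nonneg _).trans (hF x₀)
  have hΩ : IsBlockUnion k Q := isBlockUnion_cubeT hPd hk rfl hfit
  have hplaq : ∀ p : Balaban1983to89.Plaq P 0, dist1 (GaugeField.plaqHol U p) ≤ θ := fun p => by
    rw [BIJ88Smooth43Axial.dist1_eq_norm_toC_sub_one]; exact hθ p
  set φ := gBox a' P.eps⁻¹ U k Q *ᵥ f with hφ
  -- the pair distance and the radius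
  set ρ : ℕ := supDist x₀ x₁ with hρdef
  have hρ0 : (0 : ℝ) < ρ := by exact_mod_cast hρ1
  have hρn : 64 * (ρ : ℝ) ≤ n := by rw [← hnnat]; exact_mod_cast hρ64
  set r : ℕ := P.L ^ k / 8 with hrdef
  have hr8 : 8 * r ≤ P.L ^ k := Nat.mul_div_le (P.L ^ k) 8
  have hr8' : P.L ^ k < 8 * (r + 1) := by rw [hrdef]; omega
  have hrn : 8 * (r : ℝ) ≤ n := by rw [← hnnat]; exact_mod_cast hr8
  have hrn' : n ≤ 8 * r + 8 := by
    have h : ((P.L ^ k : ℕ) : ℝ) ≤ ((8 * (r + 1) : ℕ) : ℝ) := by exact_mod_cast hr8'.le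
    rw [hnnat] at h; push_cast at h; linarith
  have hρ1' : (1 : ℝ) ≤ ρ := by exact_mod_cast hρ1
  have hn1 : (1 : ℝ) ≤ n := by linarith
  have hr7 : (7 : ℝ) ≤ r := by linarith
  have hr4 : 4 ≤ r := by exact_mod_cast (show (4 : ℝ) ≤ r by linarith)
  have hr0 : (0 : ℝ) < r := by linarith
  have hr16 : n ≤ 16 * r := by linarith
  have hρr : 2 * ρ + 4 ≤ r := by
    have h1 : 2 * (ρ : ℝ) + 4 ≤ r := by linarith
    exact_mod_cast h1
  have hN' : 4 * r + 6 ≤ P.sitesPerDir 0 := by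
    have h1 := two_mul_pow_le_sitesPerDir (P := P) hk
    omega
  have hRb : 2 * (2 * r) + 4 < P.sitesPerDir 0 := by omega
  -- the deep ball: the `(2r+1)`-ball lies in `□`, the bonds of the `2r`-ball are `L^k`-deep
  obtain ⟨hinQ, hdeepz⟩ := deep_of_ball (P := P) hr8 hdeep
  -- exponential bookkeeping
  set E : ℝ := Real.exp (-(t * D / n)) with hEdef
  have hE0 : 0 < E := Real.exp_pos _
  have hexpD : ∀ {D₁ D₂ : ℝ}, D₂ ≤ D₁ → Real.exp (-(t * D₁ / n)) ≤ Real.exp (-(t * D₂ / n)) := fun h =>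
    Real.exp_le_exp.2 (by rw [neg_le_neg_iff]; exact div_le_div_of_nonneg_right (mul_le_mul_of_nonneg_left h ht.le) hn.le)
  have hexp_t₁ : ∀ {D' : ℝ}, 0 ≤ D' → Real.exp (-(t₁ * D' / n)) ≤ Real.exp (-(t * D' / n)) := fun hD' =>
    Real.exp_le_exp.2 (by rw [neg_le_neg_iff]; exact div_le_div_of_nonneg_right (mul_le_mul_of_nonneg_right htt₁ hD') hn.le)
  have hexp_t₂ : ∀ {D' : ℝ}, 0 ≤ D' → Real.exp (-(t₂ * D' / n)) ≤ Real.exp (-(t * D' / n)) := fun hD' =>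
    Real.exp_le_exp.2 (by rw [neg_le_neg_iff]; exact div_le_div_of_nonneg_right (mul_le_mul_of_nonneg_right htt₂ hD') hn.le)
  have hslack1 : Real.exp (t * (2 * r) / n) ≤ e := by
    rw [hedef]; refine Real.exp_le_exp.2 ?_
    rw [div_le_one hn]
    have h1 : t * (2 * r) ≤ 1 * (2 * r) := mul_le_mul_of_nonneg_right ht1 (by positivity)
    linarith
  have hslack3 : Real.exp (t * (2 * r + n + 1) / n) ≤ e ^ 3 := by
    rw [hedef, ← Real.exp_nat_mul]; refine Real.exp_le_exp.2 ?_
    rw [div_le_iff₀ hn]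
    have h1 : t * (2 * r + n + 1) ≤ 1 * (2 * r + n + 1) := mul_le_mul_of_nonneg_right ht1 (by positivity)
    push_cast
    linarith
  -- distance bookkeeping: `dist(z, supp f) ≥ D − |x₀ − z|_∞`
  have hsuppz : ∀ z w, f w ≠ 0 → max (D - supDist x₀ z) 0 ≤ (supDist z w : ℝ) := fun z w hw => by
    refine max_le ?_ (Nat.cast_nonneg _)
    have h1 := hsupp w hw
    have h2 := supDist_triangle x₀ z w
    have : ((supDist x₀ w : ℕ) : ℝ) ≤ ((supDist x₀ z + supDist z w : ℕ) : ℝ) := by exact_mod_cast h2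
    push_cast at this; linarith
  ----------------------------------------------------------------------------------------------------------------
  -- the gauge
  set hg := centredGaugeDir U x₀ (2 * r) i with hhg
  set U' := GaugeField.gaugeAct hg U with hU'
  set ψ : Balaban1983to89.Site P 0 → ℂ := fun z => toC (hg z) * φ z with hψdef
  -- the torus source of the gauge copy (`= h·f` on the deep ball)
  set f' : Balaban1983to89.Site P 0 → ℂ := nOp a' P.eps⁻¹ U' k univ *ᵥ ψ with hf'def
  have hψeq : nOp a' P.eps⁻¹ U' k univ *ᵥ ψ = f' := rfl
  have hf'z : ∀ z, supDist x₀ z ≤ 2 * r → f' z = toC (hg z) * f z := by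
    intro z hz
    have hzQ : z ∈ Q := hinQ z (by omega)
    have hs : ∀ ν, z.shift ν ∈ Q := fun ν => hinQ _ ((supDist_shift_le_succ x₀ z ν).trans (by omega))
    have hu : ∀ ν, z.unshift ν ∈ Q := fun ν => hinQ _ ((supDist_unshift_le_succ x₀ z ν).trans (by omega))
    exact source_eq_on_ball hk0 hc' ha' hg U hΩ f hzQ hs hu
  have hnormψ : ∀ z, ‖ψ z‖ = ‖φ z‖ := fun z => by simp only [hψdef]; rw [norm_mul, norm_toC, one_mul]
  have hnormf' : ∀ z, supDist x₀ z ≤ 2 * r → ‖f' z‖ = ‖f z‖ := fun z hz => by rw [hf'z z hz, norm_mul, norm_toC, one_mul]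
  have hcov : ∀ z ν, ‖cfg U' ⟨z, ν⟩ * ψ (z.shift ν) - ψ z‖ = ‖cfg U ⟨z, ν⟩ * φ (z.shift ν) - φ z‖ := fun z ν =>
    norm_covDiff_gaugeAct hg U φ z ν
  set γ : ℝ := ((P.d - 1 : ℕ) : ℝ) * θ with hγdef
  have hγ0 : 0 ≤ γ := by positivity
  have hγn : γ * n ^ 2 ≤ 1 := gamma_nsq_le_one hθ0 hd1' hsmall
  have hgauge : ∀ z ν, supDist x₀ z ≤ 2 * r → ‖cfg U' ⟨z, ν⟩ - 1‖ ≤ γ * ((min (supDist x₀ z) (supDist x₁ z) : ℕ) : ℝ) := by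
    intro z ν hz
    have h1 := dist1_centredGaugeDir_le_min U hθ0 hplaq x₀ hRb i hx₁ z hz ν
    rw [BIJ88Smooth43Axial.dist1_eq_norm_toC_sub_one] at h1
    calc ‖cfg U' ⟨z, ν⟩ - 1‖ = ‖toC (GaugeField.gaugeAct hg U ⟨z, ν⟩) - 1‖ := rfl
      _ ≤ ((P.d - 1 : ℕ) : ℝ) * ((min (supDist x₀ z) (supDist x₁ z) : ℕ) : ℝ) * θ := h1
      _ = γ * ((min (supDist x₀ z) (supDist x₁ z) : ℕ) : ℝ) := by rw [hγdef]; ring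
  -- the axis bonds are trivial
  have haxis : ∀ (z : Balaban1983to89.Site P 0) (μ' : Fin P.d), (∀ ν, ν ≠ i → z ν = x₀ ν) → supDist x₀ z ≤ ρ →
      cfg U' ⟨z, μ'⟩ = 1 := by
    intro z μ' hz hzρ
    have hz2 : supDist x₀ z ≤ 2 * r := by omega
    have h1 := dist1_centredGaugeDir_le U hθ0 hplaq x₀ hRb i z hz2 μ' (n := 0) (fun ν hν => by
      rw [hz ν hν, sub_self]; exact le_of_eq ((B3TorusRadialSums.cdist_eq_zero_iff _).2 rfl))
    rw [Nat.cast_zero, mul_zero, zero_mul, BIJ88Smooth43Axial.dist1_eq_norm_toC_sub_one] at h1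
    exact sub_eq_zero.1 (norm_le_zero_iff.1 h1)
  refine ⟨haxis, ?_⟩
  ----------------------------------------------------------------------------------------------------------------
  -- the local data
  set S : ℝ := c_v * P.spacing k ^ 2 * F * E * e ^ 3 with hSdef
  have hS0 : 0 ≤ S := by positivity
  have hSψ : ∀ z, supDist x₀ z ≤ 2 * r + P.L ^ k + 1 → ‖ψ z‖ ≤ S := by
    intro z hz
    rw [hnormψ]
    refine (hvalP z f F _ hF (hsuppz z)).trans ?_
    have h2 : Real.exp (-(t₁ * max (D - supDist x₀ z) 0 / n)) ≤ E * e ^ 3 := by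
      refine ((hexp_t₁ (le_max_right _ _)).trans (hexpD (le_max_left _ _))).trans ?_
      have hz' : (supDist x₀ z : ℝ) ≤ 2 * r + n + 1 := by
        have : ((supDist x₀ z : ℕ) : ℝ) ≤ ((2 * r + P.L ^ k + 1 : ℕ) : ℝ) := by exact_mod_cast hz
        push_cast at this; rw [hndef]; exact this
      calc Real.exp (-(t * (D - supDist x₀ z) / n)) = E * Real.exp (t * supDist x₀ z / n) := by
            rw [hEdef, ← Real.exp_add]; congr 1; ring
        _ ≤ E * Real.exp (t * (2 * r + n + 1) / n) := by
            refine mul_le_mul_of_nonneg_left (Real.exp_le_exp.2 ?_) hE0.le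
            exact div_le_div_of_nonneg_right (mul_le_mul_of_nonneg_left hz' ht.le) hn.le
        _ ≤ E * e ^ 3 := mul_le_mul_of_nonneg_left hslack3 hE0.le
    calc c_v * P.spacing k ^ 2 * Real.exp (-(t₁ * max (D - ↑(supDist x₀ z)) 0 / n)) * F
        ≤ c_v * P.spacing k ^ 2 * (E * e ^ 3) * F := by gcongr
      _ = S := by rw [hSdef]; ring
  set Mloc : ℝ := P.eps * (c_d * P.spacing k * F * E * e) with hMlocdef
  have hMloc0 : 0 ≤ Mloc := by positivity
  have hMψ : ∀ z ν, supDist x₀ z ≤ 2 * r → ‖cfg U' ⟨z, ν⟩ * ψ (z.shift ν) - ψ z‖ ≤ Mloc := by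
    intro z ν hz
    rw [hcov]
    have h1 := hderP z ν f F _ hF (hsuppz z) (hdeepz z hz)
    have hcovD : ‖covD P.eps⁻¹ (cfg U) φ ⟨z, ν⟩‖ = P.eps⁻¹ * ‖cfg U ⟨z, ν⟩ * φ (z.shift ν) - φ z‖ := by
      show ‖((P.eps⁻¹ : ℝ) : ℂ) * (cfg U ⟨z, ν⟩ * φ (z.shift ν) - φ z)‖ = _
      rw [norm_mul, Complex.norm_real, Real.norm_of_nonneg (inv_nonneg.2 hε.le)]
    rw [hcovD] at h1
    have h2 : Real.exp (-(t₂ * max (D - supDist x₀ z) 0 / n)) ≤ E * e := by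
      refine ((hexp_t₂ (le_max_right _ _)).trans (hexpD (le_max_left _ _))).trans ?_
      have hz' : (supDist x₀ z : ℝ) ≤ 2 * r := by exact_mod_cast hz
      calc Real.exp (-(t * (D - supDist x₀ z) / n)) = E * Real.exp (t * supDist x₀ z / n) := by
            rw [hEdef, ← Real.exp_add]; congr 1; ring
        _ ≤ E * Real.exp (t * (2 * r) / n) := by
            refine mul_le_mul_of_nonneg_left (Real.exp_le_exp.2 ?_) hE0.le
            exact div_le_div_of_nonneg_right (mul_le_mul_of_nonneg_left hz' ht.le) hn.le
        _ ≤ E * e := mul_le_mul_of_nonneg_left hslack1 hE0.le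
    have h3 : ‖cfg U ⟨z, ν⟩ * φ (z.shift ν) - φ z‖ ≤ P.eps * (c_d * P.spacing k * Real.exp (-(t₂ * max (D - ↑(supDist x₀ z)) 0 / n)) * F) := by
      have := mul_le_mul_of_nonneg_left h1 hε.le
      rwa [← mul_assoc, mul_inv_cancel₀ hε.ne', one_mul] at this
    refine h3.trans ?_
    rw [hMlocdef]
    refine mul_le_mul_of_nonneg_left ?_ hε.le
    calc c_d * P.spacing k * Real.exp (-(t₂ * max (D - ↑(supDist x₀ z)) 0 / n)) * F ≤ c_d * P.spacing k * (E * e) * F := by gcongr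
      _ = c_d * P.spacing k * F * E * e := by ring
  set Floc : ℝ := F * E * e with hFlocdef
  have hFloc0 : 0 ≤ Floc := by positivity
  have hFf' : ∀ z, supDist x₀ z ≤ 2 * r → ‖f' z‖ ≤ Floc := by
    intro z hz
    rw [hnormf' z hz]
    by_cases hfz : f z = 0
    · rw [hfz, norm_zero]; exact hFloc0
    · have h1 : D ≤ 2 * r := by
        have := hsupp z hfz
        have h2 : ((supDist x₀ z : ℕ) : ℝ) ≤ ((2 * r : ℕ) : ℝ) := by exact_mod_cast hz
        push_cast at h2; linarith
      have h2 : 1 ≤ E * e := by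
        have h3 : Real.exp (-(t * (2 * r) / n)) ≤ E := hexpD h1
        have h4 : Real.exp (-(t * (2 * r) / n)) * Real.exp (t * (2 * r) / n) = 1 := by
          rw [← Real.exp_add, neg_add_cancel, Real.exp_zero]
        calc (1 : ℝ) = Real.exp (-(t * (2 * r) / n)) * Real.exp (t * (2 * r) / n) := h4.symm
          _ ≤ E * e := mul_le_mul h3 hslack1 (Real.exp_pos _).le hE0.le
      calc ‖f z‖ ≤ F := hF z
        _ = F * 1 := (mul_one F).symm
        _ ≤ F * (E * e) := mul_le_mul_of_nonneg_left h2 hF0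
        _ = Floc := by rw [hFlocdef]; ring
  -- the Hölder envelopes of the difference kernel
  have hPdR : (P.d : ℝ) = ((d + 1 : ℕ) : ℝ) := by rw [hPd]
  set A : ℝ := C_H * P.eps ^ 2 * (ρ : ℝ) ^ α with hAdef
  have hA0 : 0 ≤ A := by positivity
  have hK1 : ∀ z, |((B1RG242Torus.tower P a 0).G k (x₁.shift μ) z - (B1RG242Torus.tower P a 0).G k x₁ z) -
      ((B1RG242Torus.tower P a 0).G k (x₀.shift μ) z - (B1RG242Torus.tower P a 0).G k x₀ z)| ≤
      A / (max ((min (supDist x₀ z) (supDist x₁ z) : ℕ) : ℝ) 1) ^ ((P.d : ℝ) - 1 + α) := fun z => by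
    rw [hAdef, hPdR]; exact hholP.1 μ x₀ x₁ z
  have hK2 : ∀ (ν : Fin P.d) z,
      |(((B1RG242Torus.tower P a 0).G k (x₁.shift μ) (z.shift ν) - (B1RG242Torus.tower P a 0).G k x₁ (z.shift ν)) -
          ((B1RG242Torus.tower P a 0).G k (x₀.shift μ) (z.shift ν) - (B1RG242Torus.tower P a 0).G k x₀ (z.shift ν))) -
        (((B1RG242Torus.tower P a 0).G k (x₁.shift μ) z - (B1RG242Torus.tower P a 0).G k x₁ z) -
          ((B1RG242Torus.tower P a 0).G k (x₀.shift μ) z - (B1RG242Torus.tower P a 0).G k x₀ z))| ≤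
      A / (max ((min (supDist x₀ z) (supDist x₁ z) : ℕ) : ℝ) 1) ^ ((P.d : ℝ) + α) := fun ν z => by
    have h := hholP.2 μ ν x₀ x₁ z
    rw [hAdef, hPdR]
    refine le_trans (le_of_eq ?_) h
    congr 1; ring
  -- THE LOCAL ESTIMATE
  have hmain := hloc P hPd ha hk1 hkK hr4 hN' x₀ x₁ μ hρr U' ψ f' hψeq hA0 hγ0 hS0 hMloc0 hFloc0 hK1 hK2 hgauge hSψ hMψ hFf'
  -- its left-hand side is the target quantity
  have hLHS : (toC (hg (x₁.shift μ)) * φ (x₁.shift μ) - toC (hg x₁) * φ x₁) - (toC (hg (x₀.shift μ)) * φ (x₀.shift μ) - toC (hg x₀) * φ x₀) =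
      (ψ (x₁.shift μ) - ψ x₁) - (ψ (x₀.shift μ) - ψ x₀) := rfl
  rw [hLHS]
  refine hmain.trans ?_
  ----------------------------------------------------------------------------------------------------------------
  -- the powers
  set Pw : ℝ := (r : ℝ) ^ (1 - α) with hPw
  set Qw : ℝ := ((r : ℝ) + (P.L : ℝ) ^ k) ^ (1 - α) with hQw
  set W : ℝ := (ρ : ℝ) ^ α * n ^ (1 - α) with hWdef
  have h1α : 0 ≤ 1 - α := by linarith
  have hρα : 0 ≤ (ρ : ℝ) ^ α := Real.rpow_nonneg hρ0.le α
  have hnα : 0 < n ^ (1 - α) := Real.rpow_pos_of_pos hn _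
  have hW0 : 0 ≤ W := by positivity
  have hWeq : ((ρ : ℝ) / n) ^ α * n = W := div_rpow_mul_eq hρ0.le hn
  have p1 : Pw ≤ n ^ (1 - α) := Real.rpow_le_rpow hr0.le (by linarith) h1α
  have p2 : Qw ≤ 2 * n ^ (1 - α) := by
    rw [hQw, ← hndef]
    exact rpow_le_mul_rpow (by norm_num) (by positivity) hn.le (by linarith) h1α (by linarith)
  have p3 : (r : ℝ) ^ (-α) ≤ 16 * n ^ (-α) := rpow_neg_le_of_le_mul hr0 hn hr16 hα0 hα1.le
  have p4 : n ^ (-α) * n = n ^ (1 - α) := by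
    rw [show (1 : ℝ) - α = -α + 1 by ring, Real.rpow_add hn, Real.rpow_one]
  have hsp2 : P.spacing k ^ 2 = n ^ 2 * P.eps ^ 2 := by rw [hsp]; ring
  -- the five terms against `W ε² E F`
  have q1 : Floc * A * Pw ≤ (C_H * e) * (W * P.eps ^ 2 * E * F) := by
    calc Floc * A * Pw = (C_H * e) * ((ρ : ℝ) ^ α * Pw) * P.eps ^ 2 * E * F := by rw [hFlocdef, hAdef]; ring
      _ ≤ (C_H * e) * ((ρ : ℝ) ^ α * n ^ (1 - α)) * P.eps ^ 2 * E * F := by gcongr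
      _ = (C_H * e) * (W * P.eps ^ 2 * E * F) := by rw [hWdef]; ring
  have q2 : P.eps⁻¹ ^ 2 * (γ * A * (r * Pw * Mloc)) ≤ (C_H * (c_d * e)) * (W * P.eps ^ 2 * E * F) := by
    have e1 : P.eps⁻¹ ^ 2 * (γ * A * (r * Pw * Mloc)) = (C_H * (c_d * e)) * ((γ * (r * n)) * ((ρ : ℝ) ^ α * Pw)) * P.eps ^ 2 * E * F := by
      rw [hAdef, hMlocdef, hsp]; field_simp
    rw [e1]
    have h1 : γ * (r * n) ≤ 1 := by
      calc γ * (r * n) ≤ γ * (n * n) := by gcongr; linarith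
        _ = γ * n ^ 2 := by ring
        _ ≤ 1 := hγn
    have h2 : (γ * (r * n)) * ((ρ : ℝ) ^ α * Pw) ≤ 1 * ((ρ : ℝ) ^ α * n ^ (1 - α)) :=
      mul_le_mul h1 (mul_le_mul_of_nonneg_left p1 hρα) (by positivity) zero_le_one
    calc (C_H * (c_d * e)) * ((γ * (r * n)) * ((ρ : ℝ) ^ α * Pw)) * P.eps ^ 2 * E * F
        ≤ (C_H * (c_d * e)) * (1 * ((ρ : ℝ) ^ α * n ^ (1 - α))) * P.eps ^ 2 * E * F := by gcongr
      _ = (C_H * (c_d * e)) * (W * P.eps ^ 2 * E * F) := by rw [hWdef]; ring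
  have q3 : P.eps⁻¹ ^ 2 * (γ * A * (Pw * S)) ≤ (C_H * (c_v * e ^ 3)) * (W * P.eps ^ 2 * E * F) := by
    have e1 : P.eps⁻¹ ^ 2 * (γ * A * (Pw * S)) = (C_H * (c_v * e ^ 3)) * ((γ * n ^ 2) * ((ρ : ℝ) ^ α * Pw)) * P.eps ^ 2 * E * F := by
      rw [hAdef, hSdef, hsp2]; field_simp
    rw [e1]
    have h2 : (γ * n ^ 2) * ((ρ : ℝ) ^ α * Pw) ≤ 1 * ((ρ : ℝ) ^ α * n ^ (1 - α)) :=
      mul_le_mul hγn (mul_le_mul_of_nonneg_left p1 hρα) (by positivity) zero_le_one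
    calc (C_H * (c_v * e ^ 3)) * ((γ * n ^ 2) * ((ρ : ℝ) ^ α * Pw)) * P.eps ^ 2 * E * F
        ≤ (C_H * (c_v * e ^ 3)) * (1 * ((ρ : ℝ) ^ α * n ^ (1 - α))) * P.eps ^ 2 * E * F := by gcongr
      _ = (C_H * (c_v * e ^ 3)) * (W * P.eps ^ 2 * E * F) := by rw [hWdef]; ring
  have q4 : P.eps⁻¹ ^ 2 * (A * S * ((r : ℝ) ^ (-α) / r)) ≤ (C_H * (256 * c_v * e ^ 3)) * (W * P.eps ^ 2 * E * F) := by
    have e1 : P.eps⁻¹ ^ 2 * (A * S * ((r : ℝ) ^ (-α) / r)) =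
        (C_H * (c_v * e ^ 3)) * ((ρ : ℝ) ^ α * ((r : ℝ) ^ (-α) * (n ^ 2 / r))) * P.eps ^ 2 * E * F := by
      rw [hAdef, hSdef, hsp2]; field_simp
    rw [e1]
    have h1 : n ^ 2 / r ≤ 16 * n := by
      rw [div_le_iff₀ hr0]
      calc n ^ 2 = n * n := sq n
        _ ≤ n * (16 * r) := mul_le_mul_of_nonneg_left hr16 hn.le
        _ = 16 * n * r := by ring
    have h2 : (r : ℝ) ^ (-α) * (n ^ 2 / r) ≤ (16 * n ^ (-α)) * (16 * n) :=
      mul_le_mul p3 h1 (by positivity) (by positivity)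
    have h3 : (ρ : ℝ) ^ α * ((r : ℝ) ^ (-α) * (n ^ 2 / r)) ≤ 256 * ((ρ : ℝ) ^ α * n ^ (1 - α)) := by
      calc (ρ : ℝ) ^ α * ((r : ℝ) ^ (-α) * (n ^ 2 / r)) ≤ (ρ : ℝ) ^ α * ((16 * n ^ (-α)) * (16 * n)) :=
            mul_le_mul_of_nonneg_left h2 hρα
        _ = 256 * ((ρ : ℝ) ^ α * (n ^ (-α) * n)) := by ring
        _ = 256 * ((ρ : ℝ) ^ α * n ^ (1 - α)) := by rw [p4]
    calc (C_H * (c_v * e ^ 3)) * ((ρ : ℝ) ^ α * ((r : ℝ) ^ (-α) * (n ^ 2 / r))) * P.eps ^ 2 * E * F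
        ≤ (C_H * (c_v * e ^ 3)) * (256 * ((ρ : ℝ) ^ α * n ^ (1 - α))) * P.eps ^ 2 * E * F := by gcongr
      _ = (C_H * (256 * c_v * e ^ 3)) * (W * P.eps ^ 2 * E * F) := by rw [hWdef]; ring
  have q5 : B1RG242Torus.α P a k * A * Qw * S ≤ (C_H * (2 * a * c_v * e ^ 3)) * (W * P.eps ^ 2 * E * F) := by
    have e1 : B1RG242Torus.α P a k * A * Qw * S =
        (C_H * (c_v * e ^ 3)) * ((B1RG242Torus.α P a k * P.spacing k ^ 2) * ((ρ : ℝ) ^ α * Qw)) * P.eps ^ 2 * E * F := by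
      rw [hAdef, hSdef]; ring
    rw [e1]
    have h2 : (B1RG242Torus.α P a k * P.spacing k ^ 2) * ((ρ : ℝ) ^ α * Qw) ≤ a * (2 * ((ρ : ℝ) ^ α * n ^ (1 - α))) := by
      refine mul_le_mul hαa ?_ (by positivity) ha.le
      calc (ρ : ℝ) ^ α * Qw ≤ (ρ : ℝ) ^ α * (2 * n ^ (1 - α)) := mul_le_mul_of_nonneg_left p2 hρα
        _ = _ := by ring
    calc (C_H * (c_v * e ^ 3)) * ((B1RG242Torus.α P a k * P.spacing k ^ 2) * ((ρ : ℝ) ^ α * Qw)) * P.eps ^ 2 * E * F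
        ≤ (C_H * (c_v * e ^ 3)) * (a * (2 * ((ρ : ℝ) ^ α * n ^ (1 - α)))) * P.eps ^ 2 * E * F := by gcongr
      _ = (C_H * (2 * a * c_v * e ^ 3)) * (W * P.eps ^ 2 * E * F) := by rw [hWdef]; ring
  have hsum : Floc * A * Pw + P.eps⁻¹ ^ 2 * (γ * A * (r * Pw * Mloc + Pw * S) + A * S * ((r : ℝ) ^ (-α) / r)) +
      B1RG242Torus.α P a k * A * Qw * S ≤
      (C_H * (e + c_d * e + c_v * e ^ 3 + 256 * c_v * e ^ 3 + 2 * a * c_v * e ^ 3)) * (W * P.eps ^ 2 * E * F) := by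
    have e1 : P.eps⁻¹ ^ 2 * (γ * A * (r * Pw * Mloc + Pw * S) + A * S * ((r : ℝ) ^ (-α) / r)) =
        P.eps⁻¹ ^ 2 * (γ * A * (r * Pw * Mloc)) + P.eps⁻¹ ^ 2 * (γ * A * (Pw * S)) + P.eps⁻¹ ^ 2 * (A * S * ((r : ℝ) ^ (-α) / r)) := by
      ring
    rw [e1]
    linarith only [q1, q2, q3, q4, q5]
  have hWε : W * P.eps ^ 2 * E * F = ((ρ : ℝ) / n) ^ α * P.spacing k * P.eps * E * F := by
    rw [← hWeq, hsp]; ring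
  have hfin : C_L * ((C_H * (e + c_d * e + c_v * e ^ 3 + 256 * c_v * e ^ 3 + 2 * a * c_v * e ^ 3)) * (W * P.eps ^ 2 * E * F)) =
      K₁ * (((ρ : ℝ) / n) ^ α * P.spacing k * P.eps * E * F) := by rw [hWε, hK₁]; ring
  have hunit : 0 ≤ ((ρ : ℝ) / n) ^ α * P.spacing k * P.eps * E * F := by positivity
  calc C_L * (Floc * A * Pw + P.eps⁻¹ ^ 2 * (γ * A * (r * Pw * Mloc + Pw * S) + A * S * ((r : ℝ) ^ (-α) / r)) +
        B1RG242Torus.α P a k * A * Qw * S)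
      ≤ C_L * ((C_H * (e + c_d * e + c_v * e ^ 3 + 256 * c_v * e ^ 3 + 2 * a * c_v * e ^ 3)) * (W * P.eps ^ 2 * E * F)) :=
        mul_le_mul_of_nonneg_left hsum hCL.le
    _ = K₁ * (((ρ : ℝ) / n) ^ α * P.spacing k * P.eps * E * F) := hfin
    _ ≤ (K₁ + 1) * (((ρ : ℝ) / n) ^ α * P.spacing k * P.eps * E * F) := by nlinarith only [hunit]
    _ = (K₁ + 1) * ((supDist x₀ x₁ : ℝ) / (P.L : ℝ) ^ k) ^ α * P.spacing k * P.eps * Real.exp (-(t * D / (P.L : ℝ) ^ k)) * F := by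
        rw [hρdef, hEdef, hndef]; ring

end Leg

end

end Literature.MathematicalPhysics.QuantumFieldTheory.BalabanImbrieJaffe1984to88.BIJ88NeumannPropagatorSmallFieldCubeHolder
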